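import Summits.MatrixMultiplication.OmegaCensus.STPPAlignedDoubleKneserFilter
import Literature.Combinatorics.Additive.Vosper

/-!
# ω-census (abelian STPP census): the N18 chain at PRIME order — Vosper structure of the tight case (kernel)

HONEST FRAMING (pub-omega census; verbatim): lottery ticket; floor = certified bounds/negative ranges.
Census STRUCTURE (seat pub-omega-stpp-1 gen 28, 2026-08-28), family (b2).  A necessary condition on STPP families in `ℤ/pℤ` — a tool for
ANALYSING the residual patterns of the prime orders (59, 61, 67, …); nothing here is progress on `ω`.

## Statement

Let `(Aᵢ, Bᵢ, Cᵢ)_{i<N}` be an STPP family (CKSU 2005 Def. 5.1, the tree's `IsSTPP`) with non-empty sets in `H = ℤ/pℤ`, `p` prime, and fix a block `i`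
with another block present.  Notation of `STPPAlignedDoubleKneserFilter.lean` (filter N18, `C`-reading): `vol = aᵢbᵢcᵢ`, `Y° = ⋃_{k≠i}(C_k − B_k)`
(`L = |Y°| = Σ_{k≠i} b_k c_k`), `Z° = ⋃_{k≠i}(C_k − A_k)` (`|Z°| = Σ_{k≠i} a_k c_k`), `W = {c − a − b}` (`|W| = vol`), `V = W ⊔ ((−Aᵢ) + Y°)`,
and the inclusion `Bᵢ + V ⊆ H ∖ Z°` (`B_add_W_union_negA_add_subset`).  At prime order the only divisors are `1` and `p`, so N18 reads
(Cauchy–Davenport twice)  `|Z°| + bᵢ + vol + aᵢ + L − 2 ≤ p`.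

**Theorem (`vosper_structure_of_n18_tight`).**  If this holds with EQUALITY (the pattern is "N18-tight" at the prime `p`), `aᵢ, bᵢ ≥ 2`, `L ≥ 2` and
`|Z°| ≥ 2`, then both Cauchy–Davenport steps are critical pairs away from `ℤ/pℤ`, and Vosper's theorem (tree: `vosper_inverse`, Nathanson Thm 2.7) gives
nonzero `d, d′` with:  `Aᵢ` and `Y°` arithmetic progressions of common difference `d`;  `Bᵢ`, `V`, `H ∖ Z°` — hence `Z°` itself (`IsAP.compl`) —
arithmetic progressions of common difference `d′`; and `Bᵢ + V = H ∖ Z°` exactly.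

So an N18-tight residual pattern at a prime order can only be realised by NESTED-PROGRESSION families: every `Y_k = C_k − B_k` (`k ≠ i`) is a
sub-interval tiling of one progression and every `Z_k = C_k − A_k` of another.  (Measured 2026-08-28, numbers only, HOME `pub-omega-stpp-1-g28/`: 11 of the
21 ℤ₅₉ residues alive after the 2-block cores are N18-tight.)  The clash itself — whether the rectified integer-interval model admits the card vector — is
a per-pattern finite question left to a successor file; this file is the reusable reduction.

References: A. G. Vosper, J. London Math. Soc. 31 (1956); M. B. Nathanson, *Additive Number Theory: Inverse Problems*, GTM 165, Thm 2.2, Thm 2.7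
(tree: `Literature.Combinatorics.Additive.Vosper`); H. Cohn, R. Kleinberg, B. Szegedy, C. Umans, FOCS 2005 (arXiv:math/0511460), Def. 5.1.
-/

open Finset
open scoped Pointwise

namespace Summit.MatrixMultiplication.OmegaCensus.CubeNB

open Literature.Computability.AlgebraicComplexity
open Literature.Combinatorics.Additive
open Summit.MatrixMultiplication.OmegaCensus.STPPKneser

variable {p : ℕ} [hp : Fact p.Prime] {N : ℕ} {A B C : Fin N → Finset (ZMod p)}

/-- The image of `Aᵢ` under `a ↦ 0 − a` is the pointwise negation `−Aᵢ`. [folklore] -/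
theorem image_zero_sub_eq_neg (S : Finset (ZMod p)) : S.image (fun a => (0 : ZMod p) - a) = -S := by
  ext x
  simp only [Finset.mem_image, zero_sub, Finset.mem_neg']
  constructor
  · rintro ⟨a, ha, rfl⟩
    rwa [neg_neg]
  · intro hx
    exact ⟨-x, hx, neg_neg x⟩

/-- **Vosper structure of an N18-tight block at prime order** (`C`-reading).  See the module docstring.
[cite: Vosper1956, main theorem; Nathanson1996, Thm 2.7] [cite: CohnKleinbergSzegedyUmans2005, Def. 5.1] -/
theorem vosper_structure_of_n18_tight (hS : IsSTPP A B C) (hA : ∀ i, (A i).Nonempty) (hB : ∀ i, (B i).Nonempty)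
    (hC : ∀ i, (C i).Nonempty) (i : Fin N) (hI : (univ.erase i : Finset (Fin N)).Nonempty)
    (h2A : 2 ≤ #(A i)) (h2B : 2 ≤ #(B i)) (h2Y : 2 ≤ ∑ k ∈ univ.erase i, #(B k) * #(C k))
    (h2Z : 2 ≤ ∑ k ∈ univ.erase i, #(A k) * #(C k))
    (htight : ∑ k ∈ univ.erase i, #(A k) * #(C k) + #(B i) + #(A i) * #(B i) * #(C i) + #(A i) +
        ∑ k ∈ univ.erase i, #(B k) * #(C k) = p + 2) :
    (∃ d : ZMod p, d ≠ 0 ∧ IsAP (A i) d ∧ IsAP (DU B C (univ.erase i)) d) ∧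
    (∃ d' : ZMod p, d' ≠ 0 ∧ IsAP (B i) d' ∧ IsAP (DU A C (univ.erase i)) d' ∧
      IsAP (B i + ((((A i) ×ˢ ((B i) ×ˢ (C i))).image fun q : ZMod p × ZMod p × ZMod p => (0 : ZMod p) + q.2.2 - q.1 - q.2.1) ∪
        ((A i).image (fun a => (0 : ZMod p) - a) + DU B C (univ.erase i)))) d' ∧
      B i + ((((A i) ×ˢ ((B i) ×ˢ (C i))).image fun q : ZMod p × ZMod p × ZMod p => (0 : ZMod p) + q.2.2 - q.1 - q.2.1) ∪
        ((A i).image (fun a => (0 : ZMod p) - a) + DU B C (univ.erase i))) = univ \ DU A C (univ.erase i)) := by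
  have hp2 : 2 ≤ p := hp.out.two_le
  have hcardp : Fintype.card (ZMod p) = p := ZMod.card p
  set W := ((A i) ×ˢ ((B i) ×ˢ (C i))).image fun q : ZMod p × ZMod p × ZMod p => (0 : ZMod p) + q.2.2 - q.1 - q.2.1 with hW
  set S := (A i).image (fun a => (0 : ZMod p) - a) with hSdef
  set Yo := DU B C (univ.erase i) with hYo
  set Zo := DU A C (univ.erase i) with hZo
  have hWcard : #W = #(A i) * #(B i) * #(C i) := card_image_blockSum hS i 0
  have hScard : #S = #(A i) := Finset.card_image_of_injective _ (sub_right_injective)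
  have hYcard : #Yo = ∑ k ∈ univ.erase i, #(B k) * #(C k) := card_DU_BC hS hA _
  have hZcard : #Zo = ∑ k ∈ univ.erase i, #(A k) * #(C k) := card_DU_AC hS hB _
  have hSne : S.Nonempty := (hA i).image _
  have hYne : Yo.Nonempty := DU_nonempty hI hB hC
  have hWV : Disjoint W (S + Yo) := disjoint_W_negA_add_DU hS i
  have hVcard : #(W ∪ (S + Yo)) = #W + #(S + Yo) := Finset.card_union_of_disjoint hWV
  have hVne : (W ∪ (S + Yo)).Nonempty := (hSne.add hYne).mono Finset.subset_union_right
  have hsub : B i + (W ∪ (S + Yo)) ⊆ univ \ Zo := B_add_W_union_negA_add_subset hS i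
  have hvol : 1 ≤ #(A i) * #(B i) * #(C i) :=
    Nat.mul_pos (Nat.mul_pos (hA i).card_pos (hB i).card_pos) (hC i).card_pos
  -- cardinality of the target `H ∖ Z°`
  have hU : #(univ \ Zo) = p - #Zo := by
    rw [Finset.card_sdiff_of_subset (Finset.subset_univ _), Finset.card_univ, hcardp]
  have hZle : #Zo ≤ p := by have h := Finset.card_le_univ Zo; rwa [hcardp] at h
  have hBV_le : #(B i + (W ∪ (S + Yo))) ≤ p - #Zo := hU ▸ Finset.card_le_card hsub
  -- first Cauchy–Davenport: S + Yo is not all of ℤ/pℤ (it misses W, which is non-empty)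
  have hWne : W.Nonempty := Finset.card_pos.1 (by rw [hWcard]; exact hvol)
  have hSY_ne_univ : S + Yo ≠ univ := by
    intro h
    obtain ⟨w, hw⟩ := hWne
    exact Finset.disjoint_left.1 hWV hw (h ▸ Finset.mem_univ w)
  have hcd1 : #S + #Yo ≤ #(S + Yo) + 1 := Vosper.cauchy_davenport_of_ne_univ hSne hYne hSY_ne_univ
  -- second Cauchy–Davenport: Bᵢ + V misses Z° (non-empty)
  have hZne : Zo.Nonempty := Finset.card_pos.1 (by rw [hZcard]; omega)
  have hBV_ne_univ : B i + (W ∪ (S + Yo)) ≠ univ := by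
    intro h
    obtain ⟨z, hz⟩ := hZne
    have := hsub (h ▸ Finset.mem_univ z)
    rw [Finset.mem_sdiff] at this
    exact this.2 hz
  have hcd2 : #(B i) + #(W ∪ (S + Yo)) ≤ #(B i + (W ∪ (S + Yo))) + 1 :=
    Vosper.cauchy_davenport_of_ne_univ (hB i) hVne hBV_ne_univ
  -- tightness forces equality in both steps and in the inclusion
  rw [hScard, hYcard] at hcd1
  rw [hVcard, hWcard] at hcd2
  rw [hZcard] at hBV_le hZle
  have heq1 : #(S + Yo) = #(A i) + ∑ k ∈ univ.erase i, #(B k) * #(C k) - 1 := by omega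
  have heq2 : #(B i + (W ∪ (S + Yo))) + 1 = #(B i) + #(W ∪ (S + Yo)) := by
    rw [hVcard, hWcard]; omega
  have heq3 : #(B i + (W ∪ (S + Yo))) = p - ∑ k ∈ univ.erase i, #(A k) * #(C k) := by omega
  -- Vosper, first pair
  have h2S : 2 ≤ #S := by rw [hScard]; exact h2A
  have h2Yo : 2 ≤ #Yo := by rw [hYcard]; exact h2Y
  have hcrit1 : #(S + Yo) = #S + #Yo - 1 := by rw [hScard, hYcard]; exact heq1
  have hsmall1 : #(S + Yo) ≤ p - 2 := by omega
  obtain ⟨d, hd, hSap, hYap⟩ := vosper_inverse h2S h2Yo hcrit1 hsmall1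
  have hAap : IsAP (A i) d := by
    have h := hSap.neg
    rwa [hSdef, image_zero_sub_eq_neg, neg_neg] at h
  -- Vosper, second pair
  have h2V : 2 ≤ #(W ∪ (S + Yo)) := by rw [hVcard, hWcard]; omega
  have hcrit2 : #(B i + (W ∪ (S + Yo))) = #(B i) + #(W ∪ (S + Yo)) - 1 := by omega
  have hsmall2 : #(B i + (W ∪ (S + Yo))) ≤ p - 2 := by omega
  obtain ⟨d', hd', hBap, hVap⟩ := vosper_inverse h2B h2V hcrit2 hsmall2
  have hBVap : IsAP (B i + (W ∪ (S + Yo))) d' := hBap.add hVap heq2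
  -- the inclusion is an equality, so `H ∖ Z°` and `Z°` are progressions with difference `d′`
  have hEq : B i + (W ∪ (S + Yo)) = univ \ Zo := by
    apply Finset.eq_of_subset_of_card_le hsub
    rw [hU, hZcard, heq3]
  have hZcompl : univ \ Zo = Zoᶜ := by
    ext x; simp [Finset.mem_sdiff, Finset.mem_compl]
  have hZoap : IsAP Zo d' := by
    have h1 : IsAP (Zoᶜ) d' := by rw [← hZcompl, ← hEq]; exact hBVap
    have h2 := h1.compl hd'
    rwa [compl_compl] at h2
  exact ⟨⟨d, hd, hAap, hYap⟩, ⟨d', hd', hBap, hZoap, hBVap, hEq⟩⟩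

/-- **Vosper structure of an N18-tight block at prime order, with the set `V`** (`C`-reading): as `vosper_structure_of_n18_tight`, exporting in
addition that `V = W ∪ ((−Aᵢ) + Y°)` itself is a progression of step `d′` (needed by the clash files, e.g. HOME VOSPER-CLASH-235-244-Z61.md).
[cite: Vosper1956, main theorem; Nathanson1996, Thm 2.7] [cite: CohnKleinbergSzegedyUmans2005, Def. 5.1] -/
theorem vosper_structure_of_n18_tight_V (hS : IsSTPP A B C) (hA : ∀ i, (A i).Nonempty) (hB : ∀ i, (B i).Nonempty)
    (hC : ∀ i, (C i).Nonempty) (i : Fin N) (hI : (univ.erase i : Finset (Fin N)).Nonempty)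
    (h2A : 2 ≤ #(A i)) (h2B : 2 ≤ #(B i)) (h2Y : 2 ≤ ∑ k ∈ univ.erase i, #(B k) * #(C k))
    (h2Z : 2 ≤ ∑ k ∈ univ.erase i, #(A k) * #(C k))
    (htight : ∑ k ∈ univ.erase i, #(A k) * #(C k) + #(B i) + #(A i) * #(B i) * #(C i) + #(A i) +
        ∑ k ∈ univ.erase i, #(B k) * #(C k) = p + 2) :
    (∃ d : ZMod p, d ≠ 0 ∧ IsAP (A i) d ∧ IsAP (DU B C (univ.erase i)) d) ∧
    (∃ d' : ZMod p, d' ≠ 0 ∧ IsAP (B i) d' ∧ IsAP (DU A C (univ.erase i)) d' ∧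
      IsAP ((((A i) ×ˢ ((B i) ×ˢ (C i))).image fun q : ZMod p × ZMod p × ZMod p => (0 : ZMod p) + q.2.2 - q.1 - q.2.1) ∪
        ((A i).image (fun a => (0 : ZMod p) - a) + DU B C (univ.erase i))) d' ∧
      IsAP (B i + ((((A i) ×ˢ ((B i) ×ˢ (C i))).image fun q : ZMod p × ZMod p × ZMod p => (0 : ZMod p) + q.2.2 - q.1 - q.2.1) ∪
        ((A i).image (fun a => (0 : ZMod p) - a) + DU B C (univ.erase i)))) d' ∧
      B i + ((((A i) ×ˢ ((B i) ×ˢ (C i))).image fun q : ZMod p × ZMod p × ZMod p => (0 : ZMod p) + q.2.2 - q.1 - q.2.1) ∪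
        ((A i).image (fun a => (0 : ZMod p) - a) + DU B C (univ.erase i))) = univ \ DU A C (univ.erase i)) := by
  have hp2 : 2 ≤ p := hp.out.two_le
  have hcardp : Fintype.card (ZMod p) = p := ZMod.card p
  set W := ((A i) ×ˢ ((B i) ×ˢ (C i))).image fun q : ZMod p × ZMod p × ZMod p => (0 : ZMod p) + q.2.2 - q.1 - q.2.1 with hW
  set S := (A i).image (fun a => (0 : ZMod p) - a) with hSdef
  set Yo := DU B C (univ.erase i) with hYo
  set Zo := DU A C (univ.erase i) with hZo
  have hWcard : #W = #(A i) * #(B i) * #(C i) := card_image_blockSum hS i 0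
  have hScard : #S = #(A i) := Finset.card_image_of_injective _ (sub_right_injective)
  have hYcard : #Yo = ∑ k ∈ univ.erase i, #(B k) * #(C k) := card_DU_BC hS hA _
  have hZcard : #Zo = ∑ k ∈ univ.erase i, #(A k) * #(C k) := card_DU_AC hS hB _
  have hSne : S.Nonempty := (hA i).image _
  have hYne : Yo.Nonempty := DU_nonempty hI hB hC
  have hWV : Disjoint W (S + Yo) := disjoint_W_negA_add_DU hS i
  have hVcard : #(W ∪ (S + Yo)) = #W + #(S + Yo) := Finset.card_union_of_disjoint hWV
  have hVne : (W ∪ (S + Yo)).Nonempty := (hSne.add hYne).mono Finset.subset_union_right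
  have hsub : B i + (W ∪ (S + Yo)) ⊆ univ \ Zo := B_add_W_union_negA_add_subset hS i
  have hvol : 1 ≤ #(A i) * #(B i) * #(C i) :=
    Nat.mul_pos (Nat.mul_pos (hA i).card_pos (hB i).card_pos) (hC i).card_pos
  -- cardinality of the target `H ∖ Z°`
  have hU : #(univ \ Zo) = p - #Zo := by
    rw [Finset.card_sdiff_of_subset (Finset.subset_univ _), Finset.card_univ, hcardp]
  have hZle : #Zo ≤ p := by have h := Finset.card_le_univ Zo; rwa [hcardp] at h
  have hBV_le : #(B i + (W ∪ (S + Yo))) ≤ p - #Zo := hU ▸ Finset.card_le_card hsub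
  -- first Cauchy–Davenport: S + Yo is not all of ℤ/pℤ (it misses W, which is non-empty)
  have hWne : W.Nonempty := Finset.card_pos.1 (by rw [hWcard]; exact hvol)
  have hSY_ne_univ : S + Yo ≠ univ := by
    intro h
    obtain ⟨w, hw⟩ := hWne
    exact Finset.disjoint_left.1 hWV hw (h ▸ Finset.mem_univ w)
  have hcd1 : #S + #Yo ≤ #(S + Yo) + 1 := Vosper.cauchy_davenport_of_ne_univ hSne hYne hSY_ne_univ
  -- second Cauchy–Davenport: Bᵢ + V misses Z° (non-empty)
  have hZne : Zo.Nonempty := Finset.card_pos.1 (by rw [hZcard]; omega)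
  have hBV_ne_univ : B i + (W ∪ (S + Yo)) ≠ univ := by
    intro h
    obtain ⟨z, hz⟩ := hZne
    have := hsub (h ▸ Finset.mem_univ z)
    rw [Finset.mem_sdiff] at this
    exact this.2 hz
  have hcd2 : #(B i) + #(W ∪ (S + Yo)) ≤ #(B i + (W ∪ (S + Yo))) + 1 :=
    Vosper.cauchy_davenport_of_ne_univ (hB i) hVne hBV_ne_univ
  -- tightness forces equality in both steps and in the inclusion
  rw [hScard, hYcard] at hcd1
  rw [hVcard, hWcard] at hcd2
  rw [hZcard] at hBV_le hZle
  have heq1 : #(S + Yo) = #(A i) + ∑ k ∈ univ.erase i, #(B k) * #(C k) - 1 := by omega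
  have heq2 : #(B i + (W ∪ (S + Yo))) + 1 = #(B i) + #(W ∪ (S + Yo)) := by
    rw [hVcard, hWcard]; omega
  have heq3 : #(B i + (W ∪ (S + Yo))) = p - ∑ k ∈ univ.erase i, #(A k) * #(C k) := by omega
  -- Vosper, first pair
  have h2S : 2 ≤ #S := by rw [hScard]; exact h2A
  have h2Yo : 2 ≤ #Yo := by rw [hYcard]; exact h2Y
  have hcrit1 : #(S + Yo) = #S + #Yo - 1 := by rw [hScard, hYcard]; exact heq1
  have hsmall1 : #(S + Yo) ≤ p - 2 := by omega
  obtain ⟨d, hd, hSap, hYap⟩ := vosper_inverse h2S h2Yo hcrit1 hsmall1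
  have hAap : IsAP (A i) d := by
    have h := hSap.neg
    rwa [hSdef, image_zero_sub_eq_neg, neg_neg] at h
  -- Vosper, second pair
  have h2V : 2 ≤ #(W ∪ (S + Yo)) := by rw [hVcard, hWcard]; omega
  have hcrit2 : #(B i + (W ∪ (S + Yo))) = #(B i) + #(W ∪ (S + Yo)) - 1 := by omega
  have hsmall2 : #(B i + (W ∪ (S + Yo))) ≤ p - 2 := by omega
  obtain ⟨d', hd', hBap, hVap⟩ := vosper_inverse h2B h2V hcrit2 hsmall2
  have hBVap : IsAP (B i + (W ∪ (S + Yo))) d' := hBap.add hVap heq2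
  -- the inclusion is an equality, so `H ∖ Z°` and `Z°` are progressions with difference `d′`
  have hEq : B i + (W ∪ (S + Yo)) = univ \ Zo := by
    apply Finset.eq_of_subset_of_card_le hsub
    rw [hU, hZcard, heq3]
  have hZcompl : univ \ Zo = Zoᶜ := by
    ext x; simp [Finset.mem_sdiff, Finset.mem_compl]
  have hZoap : IsAP Zo d' := by
    have h1 : IsAP (Zoᶜ) d' := by rw [← hZcompl, ← hEq]; exact hBVap
    have h2 := h1.compl hd'
    rwa [compl_compl] at h2
  exact ⟨⟨d, hd, hAap, hYap⟩, ⟨d', hd', hBap, hZoap, hVap, hBVap, hEq⟩⟩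


end Summit.MatrixMultiplication.OmegaCensus.CubeNB
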